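import Summits.QuantumFields.YangMills.Theorems.UnitScaleTiltProp7ChartRemainderDivLipschitz
import Summits.QuantumFields.YangMills.Theorems.UnitScaleTiltProp7ChartRemainderSupRow
import HarnessLib

/-!
# Prop 7, route-R E′, (E1-c) F4j — THE TWO CHART-REMAINDER ROWS WITH THE `u`-ROWS ELIMINATED: everything in `ψ`-rows (`m, m′, m_d, δ, δ′, δ_d`) and data rows (`β`, `ℓ²‖D*B(x)‖`)

Route `UnitScaleTilt`, crux K1 child «MinimiserStabilityRegPr» (`stmt-QuantumFields-19200`), cell ym3-torus, width seat px15 (gen 2); pen «px15 g2: (E1-c) GO-LOCATE» (★p1 g15,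
2026-08-28T20:45:05Z), LOCATE `LOCATE-E1C-DIVLIPSCHITZ-px15g2.md` §6.  THEOREMS ONLY (0 `def`, 0 `sorry`); `--supports stmt-QuantumFields-19200`, count-neutral.
YM₃ on T³ is a ladder rung (R3), not the Clay problem; nothing here claims the stub, the crux, d = 4 or the mass gap.

WHAT.  F4h ✓p675364 and F4i ⧗p675510 bound `ℓ²D*[N(ψ) − N(ψ′)]` and `N(ψ)(b) − N(ψ′)(b)` with `u`-rows (`‖u − u′‖ ≤ mᵘ_d`, `‖D_μu‖,‖D_μu′‖ ≤ K`, `‖D_μ(u − u′)‖ ≤ δᵘ_d`, `‖u‖ ≤ 1`,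
`u = e^{c•ψ}`).  F4d(iii) ✓p674383 supplies them from the `ψ`-rows: `mᵘ_d := e^{R₀}m_d`, `K := e^{R₀}(δ + δ′)`, `δᵘ_d := e^{R₀}(δ_d + 2δ′m_d)`; and `‖e^{c•ψ}‖ ≤ 1` is the C*-identity
for the unitary `e^{c•ψ}` (`norm_expField_le_one`).  ★★★ `norm_divB_chartRemainder_sub_le_psi`, ★★★ `norm_chartRemainder_bond_sub_le_psi`: the same two rows, hypotheses = transports
unitary, `(c•ψ)* = −c•ψ`, pinned fields with potential `d`, `ψ`-rows, data rows, smallness `e^{R₀}e^{R₀+δ+δ′}(δ+δ′) ≤ ½`, `e^{R₀}(δ+δ′) ≤ 1∕80`, `β ≤ 1∕40`.  Successor: `(p,q)`∕torus packaging only.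
HONEST SCOPE.  Assembly ([folklore]).

References: T. Bałaban, CMP 98 (1985) 17–51 [Balaban1985Averaging] ((19)–(21) p.21, (26), (32)–(34) p.22); CMP 99 (1985) 389–434 [Balaban1985BackgroundPropagators] ((3.8) p.392).
-/

set_option autoImplicit false

noncomputable section

open scoped BigOperators Matrix.Norms.L2Operator Matrix
open NormedSpace

namespace Summit.QuantumFields.YangMills.Theorems.Prop7ChartRemainderRowsPsi

open Literature.MathematicalPhysics.QuantumFieldTheory.Balaban1983to89
open Finset
open MatrixLog (mlog)
open B9Eq39Adjoint (R covD covDstar divB)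
open Summit.QuantumFields.YangMills.Theorems.Prop7ChartRemainderAbstractTrisection (expField_unitary)
open Summit.QuantumFields.YangMills.Theorems.Prop7ChartRemainderDivLipschitz (norm_divB_chartRemainder_sub_le)
open Summit.QuantumFields.YangMills.Theorems.Prop7ChartRemainderSupRow (norm_chartRemainder_bond_sub_le)
open Summit.QuantumFields.YangMills.Theorems.Prop7ExpFieldRows (norm_expField_sub_le norm_covD_expField_le norm_covD_expField_sub_le)
open Summit.QuantumFields.YangMills.Theorems.Prop7ResumPartPackaged (covD_sub)

variable {n : Type*} [Fintype n] [DecidableEq n] [Nonempty n]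
variable {S : Type*} {ι : Type*} (T : ι → Equiv.Perm S) (U : ι → S → (Matrix n n ℂ)ˣ)

/-- `‖e^{c•ψ}‖ ≤ 1` for skew `c•ψ` (C*-identity for the unitary `e^{c•ψ}`). [folklore] -/
theorem norm_expField_le_one {c : ℂ} {lam : Matrix n n ℂ} (hskew : star (c • lam) = -(c • lam)) : ‖exp (c • lam)‖ ≤ 1 := by
  have h := (expField_unitary hskew).1
  have h2 : ‖exp (c • lam)‖ * ‖exp (c • lam)‖ = 1 := by
    rw [← CStarRing.norm_self_mul_star, h, norm_one]
  nlinarith [norm_nonneg (exp (c • lam))]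

omit [Nonempty n] in
/-- The three `u`-rows from the `ψ`-rows (F4d(iii)). (bookkeeping) [cite: Balaban1985Averaging, (19)-(21) p.21] -/
theorem uRows_of_psiRows (hR : ∀ μ x (M : Matrix n n ℂ), ‖R (U μ x) M‖ = ‖M‖) {c : ℂ} (hc : ‖c‖ ≤ 1) (ψ ψ' : S → Matrix n n ℂ)
    {R₀ md δ δ' δd : ℝ} (hψ : ∀ y, ‖ψ y‖ ≤ R₀) (hψ' : ∀ y, ‖ψ' y‖ ≤ R₀) (hmd : ∀ y, ‖ψ y - ψ' y‖ ≤ md)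
    (hδ0 : 0 ≤ δ) (hδ : ∀ μ y, ‖covD T U μ ψ y‖ ≤ δ) (hδ'0 : 0 ≤ δ') (hδ' : ∀ μ y, ‖covD T U μ ψ' y‖ ≤ δ')
    (hδd : ∀ μ y, ‖covD T U μ (fun z => ψ z - ψ' z) y‖ ≤ δd) :
    (∀ y, ‖exp (c • ψ y) - exp (c • ψ' y)‖ ≤ Real.exp R₀ * md)
    ∧ (∀ μ y, ‖covD T U μ (fun z => exp (c • ψ z)) y‖ ≤ Real.exp R₀ * (δ + δ'))
    ∧ (∀ μ y, ‖covD T U μ (fun z => exp (c • ψ' z)) y‖ ≤ Real.exp R₀ * (δ + δ'))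
    ∧ (∀ μ y, ‖covD T U μ (fun z => exp (c • ψ z) - exp (c • ψ' z)) y‖ ≤ Real.exp R₀ * (δd + 2 * δ' * md)) := by
  have he : 0 ≤ Real.exp R₀ := (Real.exp_pos _).le
  refine ⟨fun y => (norm_expField_sub_le hc hψ hψ' y).trans (mul_le_mul_of_nonneg_left (hmd y) he),
    fun μ y => (norm_covD_expField_le T U hR hc hψ μ y).trans (mul_le_mul_of_nonneg_left ((hδ μ y).trans (le_add_of_nonneg_right hδ'0)) he),
    fun μ y => (norm_covD_expField_le T U hR hc hψ' μ y).trans (mul_le_mul_of_nonneg_left ((hδ' μ y).trans (le_add_of_nonneg_left hδ0)) he),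
    fun μ y => (norm_covD_expField_sub_le T U hR hc hψ hψ' μ y).trans (mul_le_mul_of_nonneg_left ?_ he)⟩
  have h0 : 0 ≤ ‖covD T U μ ψ' y‖ := norm_nonneg _
  have := mul_le_mul (hδ' μ y) (add_le_add (hmd (T μ y)) (hmd y)) (by positivity) hδ'0
  linarith [hδd μ y]

variable [Fintype ι]

/-- ★★★ **THE `ℓ²D*`-MEMBER IN `ψ`-ROWS** (F4h with the `u`-rows eliminated). [cite: Balaban1985Averaging, (19)-(21) p.21, (32)-(34) p.22] -/
theorem norm_divB_chartRemainder_sub_le_psi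
    (hR : ∀ μ x (M : Matrix n n ℂ), ‖R (U μ x) M‖ = ‖M‖) (hRn : ∀ μ x (M : Matrix n n ℂ), ‖R (U μ x)⁻¹ M‖ = ‖M‖)
    (hstarR : ∀ μ y (M : Matrix n n ℂ), star (R (U μ y) M) = R (U μ y) (star M))
    (hstarRinv : ∀ μ y (M : Matrix n n ℂ), R (U μ y)⁻¹ (star M) = star (R (U μ y)⁻¹ M))
    {c : ℂ} (hc : ‖c‖ ≤ 1) (ψ ψ' : S → Matrix n n ℂ)
    (hskew : ∀ y, star (c • ψ y) = -(c • ψ y)) (hskew' : ∀ y, star (c • ψ' y) = -(c • ψ' y))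
    (En : ι → S → Matrix n n ℂ) (hE : ∀ μ y, ‖En μ y - 1‖ < 1) {β : ℝ} (hβ : ∀ μ y, ‖mlog (En μ y)‖ ≤ β) (hβ40 : β ≤ 1 / 40)
    {R₀ m m' md δ δ' δd : ℝ}
    (hm : ∀ y, ‖ψ y‖ ≤ m) (hmR : m ≤ R₀) (hmhalf : m ≤ 1 / 2) (hm' : ∀ y, ‖ψ' y‖ ≤ m') (hm'R : m' ≤ R₀) (hmd : ∀ y, ‖ψ y - ψ' y‖ ≤ md)
    (hδ0 : 0 ≤ δ) (hδ : ∀ μ y, ‖covD T U μ ψ y‖ ≤ δ) (hδ'0 : 0 ≤ δ') (hδ' : ∀ μ y, ‖covD T U μ ψ' y‖ ≤ δ')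
    (hδd0 : 0 ≤ δd) (hδd : ∀ μ y, ‖covD T U μ (fun z => ψ z - ψ' z) y‖ ≤ δd)
    (C : Set S) (hC : ∀ y ∈ C, ψ y = 0) (hC' : ∀ y ∈ C, ψ' y = 0)
    (d : S → ℕ) (hd : ∀ y, y ∉ C → ∃ μ, d (T μ y) + 1 ≤ d y ∨ d ((T μ).symm y) + 1 ≤ d y)
    (hs : Real.exp R₀ * Real.exp (R₀ + (δ + δ')) * (δ + δ') ≤ 1 / 2) (hK : Real.exp R₀ * (δ + δ') ≤ 1 / 80) (ℓ : ℕ) (x : S) :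
    (ℓ : ℝ) ^ 2 * ‖divB T U (fun μ y =>
        (mlog (exp (c • ψ y) * En μ y * star (R (U μ y) (exp (c • ψ (T μ y))))) - mlog (En μ y) + c • covD T U μ ψ y)
        - (mlog (exp (c • ψ' y) * En μ y * star (R (U μ y) (exp (c • ψ' (T μ y))))) - mlog (En μ y) + c • covD T U μ ψ' y)) x‖
      ≤ (2 * (Real.exp R₀ * md) * ((ℓ : ℝ) ^ 2 * ‖divB T U (fun μ y => mlog (En μ y)) x‖)
            + 4 * (Fintype.card ι : ℝ) * (ℓ : ℝ) ^ 2 * ((Real.exp R₀ * (δd + 2 * δ' * md) + 4 * (Real.exp R₀ * (δ + δ')) * (Real.exp R₀ * md)) * β))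
        + ((2 * max ((ℓ : ℝ) * δ) m * ((ℓ : ℝ) * min (d x : ℝ) ℓ * ‖divB T U (fun μ y => (-c) • covD T U μ (fun z => ψ z - ψ' z) y) x‖)
            + 2 * Real.exp (2 * R₀) * max ((ℓ : ℝ) * δd) md * ((ℓ : ℝ) * min (d x : ℝ) ℓ * ‖divB T U (fun μ y => (-c) • covD T U μ ψ' y) x‖)
            + (Fintype.card ι : ℝ) * (ℓ : ℝ) ^ 2 * (2 * Real.exp (2 * R₀) * δ * δd + 2 * Real.exp (2 * R₀) * (δd + 4 * δ' * md) * δ')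
            + 2 * (Fintype.card ι : ℝ) * (ℓ : ℝ) ^ 2 *
              ((((Real.exp R₀ * Real.exp (R₀ + (δ + δ'))) + 2 * (Real.exp R₀ * Real.exp (R₀ + (δ + δ'))) ^ 2) * (δ + δ') * δd)
                + ((4 / 3 * (Real.exp R₀ * Real.exp (R₀ + (δ + δ'))) + 6 * (Real.exp R₀ * Real.exp (R₀ + (δ + δ'))) ^ 2) * (δ + δ') ^ 2 * md))))
        + 2 * (Fintype.card ι : ℝ) * (ℓ : ℝ) ^ 2 * (β * (24 * (Real.exp R₀ * (δ + δ')) * (Real.exp R₀ * md) + 8 * (Real.exp R₀ * (δd + 2 * δ' * md)))) := by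
  obtain ⟨hmud, hDu, hDu', hδud⟩ := uRows_of_psiRows T U hR hc ψ ψ' (fun y => (hm y).trans hmR) (fun y => (hm' y).trans hm'R) hmd hδ0 hδ hδ'0 hδ' hδd
  have hu1 : ∀ y, ‖exp (c • ψ y)‖ ≤ 1 := fun y => norm_expField_le_one (hskew y)
  have hu1' : ∀ y, ‖exp (c • ψ' y)‖ ≤ 1 := fun y => norm_expField_le_one (hskew' y)
  have hK0 : 0 ≤ Real.exp R₀ * (δ + δ') := by positivity
  have h := norm_divB_chartRemainder_sub_le T U hR hRn hstarR hstarRinv hc ψ ψ' hskew hskew' hu1 hu1' En hE hβ hβ40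
    hm hmR hmhalf hm' hm'R hmd hδ0 hδ hδ'0 hδ' hδd0 hδd C hC hC' d hd hs hmud hK0 hDu hDu' hK hδud ℓ x
  refine h.trans ?_
  -- only the P₁ site term carries `‖u x − u′ x‖` pointwise; bound it by `e^{R₀} m_d`
  have hux := hmud x
  have h0 : 0 ≤ (ℓ : ℝ) ^ 2 * ‖divB T U (fun μ y => mlog (En μ y)) x‖ := by positivity
  have := mul_le_mul_of_nonneg_right (mul_le_mul_of_nonneg_left hux (by norm_num : (0 : ℝ) ≤ 2)) h0
  linarith

omit [Fintype ι] in
/-- ★★★ **THE BOND (`ℓ·sup`) MEMBER IN `ψ`-ROWS** (F4i with the `u`-rows eliminated). [cite: Balaban1985Averaging, (19)-(21) p.21, (32)-(34) p.22] -/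
theorem norm_chartRemainder_bond_sub_le_psi
    (hR : ∀ μ x (M : Matrix n n ℂ), ‖R (U μ x) M‖ = ‖M‖)
    (hstarR : ∀ μ y (M : Matrix n n ℂ), star (R (U μ y) M) = R (U μ y) (star M))
    {c : ℂ} (hc : ‖c‖ ≤ 1) (ψ ψ' : S → Matrix n n ℂ)
    (hskew : ∀ y, star (c • ψ y) = -(c • ψ y)) (hskew' : ∀ y, star (c • ψ' y) = -(c • ψ' y))
    (En : ι → S → Matrix n n ℂ) (hE : ∀ μ y, ‖En μ y - 1‖ < 1) {β : ℝ} (hβ : ∀ μ y, ‖mlog (En μ y)‖ ≤ β) (hβ40 : β ≤ 1 / 40)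
    {R₀ m md δ δ' δd : ℝ}
    (hm : ∀ y, ‖ψ y‖ ≤ m) (hmR : m ≤ R₀) (hmhalf : m ≤ 1 / 2) (hm' : ∀ y, ‖ψ' y‖ ≤ R₀) (hmd : ∀ y, ‖ψ y - ψ' y‖ ≤ md)
    (hδ0 : 0 ≤ δ) (hδ : ∀ μ y, ‖covD T U μ ψ y‖ ≤ δ) (hδ'0 : 0 ≤ δ') (hδ' : ∀ μ y, ‖covD T U μ ψ' y‖ ≤ δ')
    (hδd : ∀ μ y, ‖covD T U μ (fun z => ψ z - ψ' z) y‖ ≤ δd)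
    (hs : Real.exp R₀ * Real.exp (R₀ + (δ + δ')) * (δ + δ') ≤ 1 / 2) (hK : Real.exp R₀ * (δ + δ') ≤ 1 / 80) (μ : ι) (y : S) :
    ‖(mlog (exp (c • ψ y) * En μ y * star (R (U μ y) (exp (c • ψ (T μ y))))) - mlog (En μ y) + c • covD T U μ ψ y)
        - (mlog (exp (c • ψ' y) * En μ y * star (R (U μ y) (exp (c • ψ' (T μ y))))) - mlog (En μ y) + c • covD T U μ ψ' y)‖
      ≤ 2 * (Real.exp R₀ * md) * β
        + (2 * m * δd + 2 * Real.exp (2 * R₀) * md * δ'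
            + (((Real.exp R₀ * Real.exp (R₀ + (δ + δ'))) + 2 * (Real.exp R₀ * Real.exp (R₀ + (δ + δ'))) ^ 2) * (δ + δ') * δd
              + (4 / 3 * (Real.exp R₀ * Real.exp (R₀ + (δ + δ'))) + 6 * (Real.exp R₀ * Real.exp (R₀ + (δ + δ'))) ^ 2) * (δ + δ') ^ 2 * md))
        + β * (24 * (Real.exp R₀ * (δ + δ')) * (Real.exp R₀ * md) + 8 * (Real.exp R₀ * (δd + 2 * δ' * md))) := by
  obtain ⟨hmud, hDu, hDu', hδud⟩ := uRows_of_psiRows T U hR hc ψ ψ' (fun y => (hm y).trans hmR) hm' hmd hδ0 hδ hδ'0 hδ' hδd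
  have hu1 : ∀ y, ‖exp (c • ψ y)‖ ≤ 1 := fun y => norm_expField_le_one (hskew y)
  have hu1' : ∀ y, ‖exp (c • ψ' y)‖ ≤ 1 := fun y => norm_expField_le_one (hskew' y)
  have hδd' : ∀ μ y, ‖covD T U μ ψ y - covD T U μ ψ' y‖ ≤ δd := fun μ y => by rw [← covD_sub]; exact hδd μ y
  have hδud' : ∀ μ y, ‖covD T U μ (fun z => exp (c • ψ z)) y - covD T U μ (fun z => exp (c • ψ' z)) y‖ ≤ Real.exp R₀ * (δd + 2 * δ' * md) :=
    fun μ y => by rw [← covD_sub]; exact hδud μ y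
  have h := norm_chartRemainder_bond_sub_le T U hstarR hc ψ ψ' hskew hskew' hu1 hu1' En hE hβ hβ40
    hm hmR hmhalf hm' hmd hδ0 hδ hδ'0 hδ' hδd' hs hmud hDu hDu' hK hδud' μ y
  refine h.trans ?_
  have hβ0 : 0 ≤ β := (norm_nonneg _).trans (hβ μ y)
  have := mul_le_mul_of_nonneg_right (mul_le_mul_of_nonneg_left (hmud y) (by norm_num : (0 : ℝ) ≤ 2)) hβ0
  linarith

end Summit.QuantumFields.YangMills.Theorems.Prop7ChartRemainderRowsPsi

end
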